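import Summits.ValiantsHypothesis.ValiantsHypothesis.Theorems.DivisionGapDefs
import Summits.ValiantsHypothesis.ValiantsHypothesis.Theorems.PerDivisionHard.Negative.PerLowDegreeRung
import Literature.Computability.AlgebraicComplexity.MonotoneStructure

/-!
# Crux `DivisionGap.PerDivisionHard` (stmt-ValiantsHypothesis-5065), line
`pair-descent-jss-endpoint` — stub `stub_torus` (step 0): WLOG the cofactor is torus-homogeneous

For every nonzero `h ∈ ℝ≥0[x_ij]` in the `n × n` matrix variables there is a nonzero `h'` all of
whose monomials have the same vector of row margins and the same vector of column margins
(`IsTorusHomogeneous h'`: `h'` is a semi-invariant of the torus `x_ij ↦ s_i t_j x_ij`, the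
lineality space of the Birkhoff polytope `Newt(per_n)`), with `L(per_n · h') ≤ L(per_n · h)` and
`L(h') ≤ L(h)` in the tree's monotone fan-in-two `complexity` over the semiring `ℝ≥0`.

Proof (two initial-form steps; the trick of `ZeroOneTransfer/Negative/LowDegreeCofactor.lean`,
`exists_rows_topComponent`).  For a map `f : [n] × [n] → [n]` (first `f = Prod.fst`, rows; then
`f = Prod.snd`, columns) and a radix `B`, the digit weight `x_v ↦ B ^ (f v)` (for `f = Prod.fst`
this is the tree's `rowWeight B`) gives a monomial `m` the weight `Σ_i (mapDomain f m) i · B ^ i`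
(`weight_digitWeight`) — the base-`B` number whose digits are the `f`-margins of `m`.  With
`B = deg p + 1` every digit of every monomial of `p` is `< B`, so the monomials of the top
component `top p` (all of the same, maximal, weight) have the same `f`-margins
(`eq_of_sum_mul_pow_eq`, base-`B` uniqueness).  The permanent is homogeneous for both digit
weights (each permutation monomial has one variable in each row and one in each column), so
`top (per · p) = per · top p` (`topComponent_mul`, `topComponent_eq_self_of_isWeightedHomogeneous`)
and initial forms are free for monotone circuits (`complexity_topComponent_le`); `top p ≠ 0`
(`topComponent_ne_zero`) and `supp (top p) ⊆ supp p` (`support_topComponent_subset`), so the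
constancy of the row margins gained in the first step survives the second.  [folklore]
-/

noncomputable section

-- `Summit.ValiantsHypothesis.ValiantsHypothesis.…` is the tree's mandated single-conjunct layout
-- (Sub = Summit), so the duplicated namespace component is intended.
set_option linter.dupNamespace false

namespace Summit.ValiantsHypothesis.ValiantsHypothesis.Theorems.DivisionGapPerDivisionHard

open MvPolynomial Literature.Computability.AlgebraicComplexity
open Summit.ValiantsHypothesis.ValiantsHypothesis.Theorems.ZeroOneTransfer.Negative
open scoped NNReal

variable {n : ℕ}

/-! ### Digit weights: margins as base-`B` digits -/

/-- For the DIGIT WEIGHT `x_v ↦ B ^ (f v)` of a map `f` on the cells in radix `B` (for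
`f = Prod.fst`: the row-lexicographic weight `rowWeight B`), the weight of a monomial is the
base-`B` number whose digits are its `f`-margins `(mapDomain f d) i = Σ_{f v = i} d v`.
[folklore] -/
theorem weight_digitWeight (f : Fin n × Fin n → Fin n) (B : ℕ) (d : (Fin n × Fin n) →₀ ℕ) :
    Finsupp.weight (fun v => B ^ ((f v : Fin n) : ℕ)) d =
      ∑ i : Fin n, Finsupp.mapDomain f d i * B ^ ((i : Fin n) : ℕ) := by
  rw [← Finsupp.sum_fintype (Finsupp.mapDomain f d) (fun i k => k * B ^ ((i : Fin n) : ℕ))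
      fun _ => zero_mul _,
    Finsupp.sum_mapDomain_index (fun _ => zero_mul _) fun _ _ _ => add_mul _ _ _,
    Finsupp.weight_apply]
  simp only [smul_eq_mul]

/-- Margins of a monomial of `p` are at most `deg p`. [folklore] -/
theorem mapDomain_apply_le_totalDegree (f : Fin n × Fin n → Fin n)
    {p : MvPolynomial (Fin n × Fin n) ℝ≥0} {d : (Fin n × Fin n) →₀ ℕ} (hd : d ∈ p.support)
    (i : Fin n) : Finsupp.mapDomain f d i ≤ p.totalDegree :=
  ((Finsupp.le_degree i _).trans_eq (Finsupp.degree_mapDomain f d)).trans (le_totalDegree hd)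

/-- **All monomials of the top digit-weight component (radix `deg p + 1`) have the same
`f`-margins** (base-`B` uniqueness of digit vectors). [folklore] -/
theorem mapDomain_eq_of_mem_support_topComponent (f : Fin n × Fin n → Fin n)
    (p : MvPolynomial (Fin n × Fin n) ℝ≥0) {d d' : (Fin n × Fin n) →₀ ℕ}
    (hd : d ∈ (topComponent (fun v => (p.totalDegree + 1) ^ ((f v : Fin n) : ℕ)) p).support)
    (hd' : d' ∈ (topComponent (fun v => (p.totalDegree + 1) ^ ((f v : Fin n) : ℕ)) p).support) :
    Finsupp.mapDomain f d = Finsupp.mapDomain f d' := by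
  set B := p.totalDegree + 1
  set W : Fin n × Fin n → ℕ := fun v => B ^ ((f v : Fin n) : ℕ)
  have hw : ∀ e ∈ (topComponent W p).support,
      Finsupp.weight W e = weightedTotalDegree W p := by
    intro e he
    have := mem_support_iff.mp he
    rw [coeff_topComponent] at this
    by_contra hne
    exact this (if_neg hne)
  have hlt : ∀ e ∈ (topComponent W p).support, ∀ i, Finsupp.mapDomain f e i < B :=
    fun e he i =>
      Nat.lt_succ_of_le (mapDomain_apply_le_totalDegree f (support_topComponent_subset _ p he) i)
  exact DFunLike.coe_injective (eq_of_sum_mul_pow_eq (⇑(Finsupp.mapDomain f d))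
    (⇑(Finsupp.mapDomain f d')) (hlt d hd) (hlt d' hd')
    (by rw [← weight_digitWeight, ← weight_digitWeight, hw d hd, hw d' hd']))

/-- The permanent is homogeneous for the digit weight of `f` whenever `f` enumerates `[n]` along
every permutation monomial (rows: `f = Prod.fst`; columns: `f = Prod.snd`): each permutation
monomial `x^{μ_π} = ∏_i x_{π i, i}` then weighs `Σ_a B ^ a`. [folklore] -/
theorem isWeightedHomogeneous_perPoly_digitWeight (f : Fin n × Fin n → Fin n) (B : ℕ)
    (hf : ∀ π : Equiv.Perm (Fin n),
      ∑ i : Fin n, B ^ ((f (π i, i) : Fin n) : ℕ) = ∑ a : Fin n, B ^ ((a : Fin n) : ℕ)) :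
    IsWeightedHomogeneous (fun v => B ^ ((f v : Fin n) : ℕ)) (perPoly (Fin n) ℝ≥0)
      (∑ a : Fin n, B ^ ((a : Fin n) : ℕ)) := by
  classical
  rw [perPoly_eq_sum_monomial]
  refine IsWeightedHomogeneous.sum _ _ _ fun π _ => ?_
  refine isWeightedHomogeneous_monomial _ _ _ ?_
  rw [permMonomial, map_sum, ← hf π]
  refine Finset.sum_congr rfl fun i _ => ?_
  rw [Finsupp.weight_apply, Finsupp.sum_single_index (by simp)]
  simp

/-! ### One degeneration step along a lineality direction of the Birkhoff polytope -/

/-- **One torus step.**  For `p ≠ 0` the top component `p'` of `p` for the digit weight of `f`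
(radix `deg p + 1`) is nonzero, has its support inside that of `p`, has constant `f`-margins,
and costs nothing: `L(per · p') ≤ L(per · p)` (the permanent is homogeneous, top components are
multiplicative and free over `ℝ≥0`) and `L(p') ≤ L(p)`. [folklore] -/
theorem exists_topComponent_const_margins (f : Fin n × Fin n → Fin n)
    (hf : ∀ (B : ℕ) (π : Equiv.Perm (Fin n)),
      ∑ i : Fin n, B ^ ((f (π i, i) : Fin n) : ℕ) = ∑ a : Fin n, B ^ ((a : Fin n) : ℕ))
    {p : MvPolynomial (Fin n × Fin n) ℝ≥0} (hp : p ≠ 0) :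
    ∃ p' : MvPolynomial (Fin n × Fin n) ℝ≥0, p' ≠ 0 ∧ p'.support ⊆ p.support ∧
      (∀ m ∈ p'.support, ∀ m' ∈ p'.support, Finsupp.mapDomain f m = Finsupp.mapDomain f m') ∧
      complexity (perPoly (Fin n) ℝ≥0 * p') ≤ complexity (perPoly (Fin n) ℝ≥0 * p) ∧
      complexity p' ≤ complexity p := by
  set W : Fin n × Fin n → ℕ := fun v => (p.totalDegree + 1) ^ ((f v : Fin n) : ℕ)
  refine ⟨topComponent W p, topComponent_ne_zero W hp, support_topComponent_subset W p,
    fun m hm m' hm' => mapDomain_eq_of_mem_support_topComponent f p hm hm', ?_,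
    complexity_topComponent_le W p⟩
  have := complexity_topComponent_le W (perPoly (Fin n) ℝ≥0 * p)
  rwa [topComponent_mul, topComponent_eq_self_of_isWeightedHomogeneous W
    (isWeightedHomogeneous_perPoly_digitWeight f _ (hf _))] at this

/-! ### The stub -/

/-- **`stub_torus` (step 0 of line `pair-descent-jss-endpoint` for `PerDivisionHard`).**  Every
nonzero cofactor `h ∈ ℝ≥0[x_ij]` may be replaced by a nonzero TORUS-HOMOGENEOUS `h'` (all
monomials share the row-margin vector and the column-margin vector) at no cost in either
monotone complexity: `L(per_n · h') ≤ L(per_n · h)` and `L(h') ≤ L(h)`.  Two initial-form steps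
(`exists_topComponent_const_margins` for `Prod.fst`, then for `Prod.snd`; supports only shrink,
so the row margins stay constant), reading `r`, `c` off one monomial of `h'`. [folklore] -/
theorem stub_torus :
    ∀ (n : ℕ) (h : MvPolynomial (Fin n × Fin n) ℝ≥0), h ≠ 0 →
      ∃ h' : MvPolynomial (Fin n × Fin n) ℝ≥0, h' ≠ 0 ∧ IsTorusHomogeneous h' ∧
        complexity (perPoly (Fin n) ℝ≥0 * h') ≤ complexity (perPoly (Fin n) ℝ≥0 * h) ∧
        complexity h' ≤ complexity h := by
  intro n h hh
  -- row step: `per` is row-homogeneous since `i ↦ π i` is a bijection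
  obtain ⟨h₁, hh₁, -, hrow, hle₁, hle₁'⟩ := exists_topComponent_const_margins Prod.fst
    (fun B π => Equiv.sum_comp π (fun a : Fin n => B ^ ((a : Fin n) : ℕ))) hh
  -- column step: `per` is column-homogeneous trivially
  obtain ⟨h₂, hh₂, hsub, hcol, hle₂, hle₂'⟩ :=
    exists_topComponent_const_margins Prod.snd (fun B π => rfl) hh₁
  obtain ⟨d₀, hd₀⟩ := exists_coeff_ne_zero hh₂
  have hd₀s : d₀ ∈ h₂.support := mem_support_iff.mpr hd₀
  refine ⟨h₂, hh₂, ⟨rowDegrees d₀, Finsupp.mapDomain Prod.snd d₀, fun m hm => ⟨?_, ?_⟩⟩,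
    hle₂.trans hle₁, hle₂'.trans hle₁'⟩
  · exact hrow m (hsub hm) d₀ (hsub hd₀s)
  · exact hcol m hm d₀ hd₀s

end Summit.ValiantsHypothesis.ValiantsHypothesis.Theorems.DivisionGapPerDivisionHard

end
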